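import Literature.MathematicalPhysics.QuantumFieldTheory.OSDistributionSpaceLaplace
import Literature.Analysis.OperatorTheory.PowerMoments
import HarnessLib

/-!
# The holomorphic semigroup `e^{-τH}` of an OS family, I: diagonal matrix elements

Osterwalder–Schrader I (CMP 31 (1973)), §4.1, p. 92: "The family `T^τ = T^t V^s`, `τ = t + is`,
is a holomorphic semigroup for `Re τ > 0`, uniformly bounded and strongly continuous for
`Re τ ≥ 0`. We can use this holomorphic semigroup to construct the analytic continuation of the
Euclidean Green's functions." OS obtain it from the spectral theorem for the generator `H ≥ 0`
of `T^t = e^{-tH}`. Here, without a spectral theorem for unbounded operators, the diagonal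
matrix elements `τ ↦ ⟪ψ, e^{-τH} ψ⟫` are **constructed and proved holomorphic** from three
landed ingredients: the Laplace representation `⟪ψ, e^{-sH}ψ⟫ = ∫ λ^s dμ_ψ(λ)` for real `s > 0`
(`OSDistributionSpaceLaplace`, with `μ_ψ` the scalar spectral measure of `e^{-H}`,
`Literature.Analysis.OperatorTheory.ScalarSpectralMeasure`), the analysis of complex power moments
`∫ t^τ dν(t)` (`Literature.Analysis.OperatorTheory.PowerMoments`), and the strong continuity of
`e^{-tH}` at `t = 0` (`OSDistributionSpaceSemigroup`), which excludes an atom of `μ_ψ` at `λ = 0`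
(`H` has no eigenvalue `+∞`):

* `osSpectralMeasureReal hE1 ψ` — `ν_ψ`, the image of `μ_ψ` on `ℝ` (finite, carried by `[0, 1]`,
  total mass `‖ψ‖²`, **no atom at `0`**: `osSpectralMeasureReal_zero`);
* `expectShiftC hE1 ψ τ := ∫ t^τ dν_ψ(t)` — the diagonal matrix element `⟪ψ, e^{-τH} ψ⟫`,
  equal to `⟪ψ, shiftH s ψ⟫` for real `τ = s > 0` (`expectShiftC_ofReal`) and to `‖ψ‖²` at
  `τ = 0` (`expectShiftC_zero`);
* `differentiableOn_expectShiftC` — holomorphic on `{Re τ > 0}`;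
  `continuousOn_expectShiftC` — continuous on `{Re τ ≥ 0}`;
  `norm_expectShiftC_le` — bounded by `‖ψ‖²` there ("uniformly bounded").

Off-diagonal matrix elements (polarization), the operators `e^{-τH}` themselves and the unitary
boundary group `e^{isH}` are the next step.

## References
* K. Osterwalder, R. Schrader, Axioms for Euclidean Green's functions, CMP 31 (1973), §4.1,
  p. 92 (the holomorphic semigroup `T^τ`).
* M. Reed, B. Simon, Methods of Modern Mathematical Physics I (rev. ed. 1980), §VII.2.
-/

noncomputable section

open MeasureTheory Set Filter
open _root_.Topology
open scoped InnerProductSpace NNReal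

-- CFC instance chain on `ℋ →L[ℂ] ℋ` (see `OSDistributionSpacePowers`).
set_option synthInstance.maxHeartbeats 200000

namespace Literature.MathematicalPhysics.QuantumFieldTheory

variable {d : ℕ} [NeZero d]

section SchwingerFamily
open Literature.MathematicalPhysics.QuantumLattice (SchwingerFamily)
open Literature.MathematicalPhysics.QuantumLattice.SchwingerFamily
open Literature.MathematicalPhysics.QuantumLattice.SchwingerFamily.OSSpace
open Literature.Analysis.OperatorTheory

variable {𝔖 : SchwingerFamily (EuclideanSpace ℝ (Fin d))} {hE2 : 𝔖.IsOSReflectionPositive}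

/-- The spectrum of `e^{-H}` is a measurable subset of `ℝ` (it is compact). [folklore] -/
theorem _root_.Literature.MathematicalPhysics.QuantumLattice.SchwingerFamily.OSSpace.measurableSet_spectrum_shiftH (t : ℝ) :
    MeasurableSet (spectrum ℝ (shiftH hE2 t)) :=
  (ContinuousFunctionalCalculus.isCompact_spectrum (R := ℝ) (shiftH hE2 t)).isClosed.measurableSet

/-- The inclusion of the spectrum of `e^{-H}` into `ℝ` is a measurable embedding. [folklore] -/
theorem _root_.Literature.MathematicalPhysics.QuantumLattice.SchwingerFamily.OSSpace.measurableEmbedding_spectrum_coe :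
    MeasurableEmbedding ((↑) : spectrum ℝ (shiftH hE2 (1 : ℝ)) → ℝ) :=
  MeasurableEmbedding.subtype_coe (measurableSet_spectrum_shiftH 1)

/-- **`ν_ψ`, the spectral measure of `e^{-H}` at `ψ` as a measure on `ℝ`** (image of
`osSpectralMeasure` under the inclusion `σ(e^{-H}) ⊆ ℝ`): a finite measure carried by `[0, 1]`.
In the variable `t = e^{-E}` this is the measure `dν_ψ(E)` with `⟪ψ, e^{-τH}ψ⟫ = ∫ e^{-τE} dν_ψ(E)`
of Osterwalder–Schrader I (1973), p. 92. [cite: OsterwalderSchraderCMP1973, §4.1 p. 92] -/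
def _root_.Literature.MathematicalPhysics.QuantumLattice.SchwingerFamily.OSSpace.osSpectralMeasureReal (hE1 : 𝔖.IsEuclideanCovariant) (ψ : OSHilbert 𝔖 hE2) : Measure ℝ :=
  (osSpectralMeasure hE1 ψ).map ((↑) : spectrum ℝ (shiftH hE2 (1 : ℝ)) → ℝ)

/-- `ν_ψ` is finite. [folklore] -/
instance _root_.Literature.MathematicalPhysics.QuantumLattice.SchwingerFamily.OSSpace.instIsFiniteMeasureOsSpectralMeasureReal (hE1 : 𝔖.IsEuclideanCovariant) (ψ : OSHilbert 𝔖 hE2) :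
    IsFiniteMeasure (osSpectralMeasureReal hE1 ψ) := by
  unfold osSpectralMeasureReal; infer_instance

/-- Integrals against `ν_ψ` are integrals against `μ_ψ`. [folklore] -/
theorem _root_.Literature.MathematicalPhysics.QuantumLattice.SchwingerFamily.OSSpace.integral_osSpectralMeasureReal (hE1 : 𝔖.IsEuclideanCovariant) (ψ : OSHilbert 𝔖 hE2)
    {E : Type*} [NormedAddCommGroup E] [NormedSpace ℝ E] (g : ℝ → E) :
    ∫ t, g t ∂(osSpectralMeasureReal hE1 ψ) = ∫ x, g (x : ℝ) ∂(osSpectralMeasure hE1 ψ) :=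
  measurableEmbedding_spectrum_coe.integral_map g

/-- `ν_ψ` is carried by `[0, 1]`. [folklore] -/
theorem _root_.Literature.MathematicalPhysics.QuantumLattice.SchwingerFamily.OSSpace.osSpectralMeasureReal_ae_mem_Icc (hE1 : 𝔖.IsEuclideanCovariant) (ψ : OSHilbert 𝔖 hE2) :
    ∀ᵐ t ∂(osSpectralMeasureReal hE1 ψ), t ∈ Icc (0 : ℝ) 1 :=
  (measurableEmbedding_spectrum_coe.ae_map_iff).2
    (Eventually.of_forall fun x => coe_mem_Icc_of_mem_spectrum_shiftH hE1 x)

/-- Total mass `ν_ψ(ℝ) = ‖ψ‖²`. [folklore] -/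
theorem _root_.Literature.MathematicalPhysics.QuantumLattice.SchwingerFamily.OSSpace.osSpectralMeasureReal_real_univ (hE1 : 𝔖.IsEuclideanCovariant) (ψ : OSHilbert 𝔖 hE2) :
    (osSpectralMeasureReal hE1 ψ).real univ = ‖ψ‖ ^ 2 := by
  rw [← osSpectralMeasure_univ_real hE1 ψ, Measure.real, Measure.real, osSpectralMeasureReal,
    measurableEmbedding_spectrum_coe.map_apply, preimage_univ]

/-- The real power integrals against `ν_ψ` are the matrix elements: `∫ t^s dν_ψ = Re ⟪ψ, e^{-sH}ψ⟫`
for `s > 0`. [folklore] -/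
theorem _root_.Literature.MathematicalPhysics.QuantumLattice.SchwingerFamily.OSSpace.integral_rpow_osSpectralMeasureReal (hE1 : 𝔖.IsEuclideanCovariant) (ψ : OSHilbert 𝔖 hE2) {s : ℝ} (hs : 0 < s) :
    ∫ t, t ^ s ∂(osSpectralMeasureReal hE1 ψ) = RCLike.re ⟪ψ, shiftH hE2 s ψ⟫_ℂ := by
  rw [integral_osSpectralMeasureReal, re_inner_shiftH_eq_integral hE1 ψ hs]

/-- **`ν_ψ` has no atom at `0`** (equivalently: `e^{-H}` has trivial kernel, `H` no eigenvalue
`+∞`). Proof: `∫ t^s dν_ψ → ν_ψ((0,∞))` as `s ↓ 0` (`tendsto_integral_rpow_nhdsGT_zero`), while the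
same quantity `Re ⟪ψ, e^{-sH}ψ⟫ → ‖ψ‖² = ν_ψ(ℝ)` by the strong continuity of the semigroup at
`0`; hence `ν_ψ((0,∞)) = ν_ψ(ℝ)` and `ν_ψ{0} ≤ ν_ψ((−∞, 0]) = 0`. [folklore] -/
theorem _root_.Literature.MathematicalPhysics.QuantumLattice.SchwingerFamily.OSSpace.osSpectralMeasureReal_zero (hE1 : 𝔖.IsEuclideanCovariant) (ψ : OSHilbert 𝔖 hE2) :
    osSpectralMeasureReal hE1 ψ {0} = 0 := by
  set ν := osSpectralMeasureReal hE1 ψ with hν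
  have h1 : Tendsto (fun s : ℝ => ∫ t, t ^ s ∂ν) (𝓝[>] 0) (𝓝 (ν.real (Ioi 0))) :=
    tendsto_integral_rpow_nhdsGT_zero (osSpectralMeasureReal_ae_mem_Icc hE1 ψ)
  have h2 : Tendsto (fun s : ℝ => ∫ t, t ^ s ∂ν) (𝓝[>] 0) (𝓝 (‖ψ‖ ^ 2)) := by
    have hc : Tendsto (fun s : ℝ => RCLike.re ⟪ψ, shiftH hE2 s ψ⟫_ℂ) (𝓝[>] 0) (𝓝 (‖ψ‖ ^ 2)) := by
      have h := ((RCLike.continuous_re.comp (continuous_inner_shiftH hE1 ψ ψ)).tendsto 0).mono_left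
        (nhdsWithin_le_nhds (s := Ioi (0 : ℝ)))
      simp only [Function.comp_apply, shiftH_zero_apply hE1, inner_self_eq_norm_sq] at h
      exact h
    refine hc.congr' ?_
    filter_upwards [self_mem_nhdsWithin] with s hs
    exact (integral_rpow_osSpectralMeasureReal hE1 ψ hs).symm
  have h3 : ν.real (Ioi 0) = ν.real univ := by
    rw [osSpectralMeasureReal_real_univ]
    exact tendsto_nhds_unique h1 h2
  have h4 : ν.real (Iic 0) = 0 := by
    have h := measureReal_add_measureReal_compl (μ := ν) (measurableSet_Ioi (a := (0 : ℝ)))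
    rw [compl_Ioi, h3] at h
    linarith
  have h5 : ν (Iic 0) = 0 := (measureReal_eq_zero_iff (measure_ne_top ν _)).1 h4
  exact measure_mono_null (singleton_subset_iff.2 (mem_Iic.2 le_rfl)) h5

/-- **The diagonal matrix element of the holomorphic semigroup**, `⟪ψ, e^{-τH} ψ⟫` for complex
`τ`: the power moment `∫ t^τ dν_ψ(t)` of the spectral measure of `e^{-H}` at `ψ`
(Osterwalder–Schrader I (1973), p. 92, `T^τ = e^{-τH}`; in the variable `t = e^{-E}`,
`∫ e^{-τE} dν_ψ(E)`). For real `τ = s > 0` it is `⟪ψ, shiftH s ψ⟫` (`expectShiftC_ofReal`). [cite: OsterwalderSchraderCMP1973, §4.1 p. 92] -/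
def _root_.Literature.MathematicalPhysics.QuantumLattice.SchwingerFamily.OSSpace.expectShiftC (hE1 : 𝔖.IsEuclideanCovariant) (ψ : OSHilbert 𝔖 hE2) (τ : ℂ) : ℂ :=
  cpowMoment (osSpectralMeasureReal hE1 ψ) τ

/-- **Agreement with the semigroup on the positive real axis**: `⟪ψ, e^{-τH}ψ⟫|_{τ = s} = ⟪ψ, shiftH s ψ⟫`
for real `s > 0`. [cite: OsterwalderSchraderCMP1973, §4.1 p. 92] -/
theorem _root_.Literature.MathematicalPhysics.QuantumLattice.SchwingerFamily.OSSpace.expectShiftC_ofReal (hE1 : 𝔖.IsEuclideanCovariant) (ψ : OSHilbert 𝔖 hE2) {s : ℝ} (hs : 0 < s) :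
    expectShiftC hE1 ψ s = ⟪ψ, shiftH hE2 s ψ⟫_ℂ := by
  rw [expectShiftC, cpowMoment_ofReal ((osSpectralMeasureReal_ae_mem_Icc hE1 ψ).mono fun _ ht => ht.1),
    integral_osSpectralMeasureReal, inner_shiftH_eq_integral hE1 ψ hs]

/-- At `τ = 0` the matrix element is `‖ψ‖²` (`t^0 = 1`, total mass). [folklore] -/
theorem _root_.Literature.MathematicalPhysics.QuantumLattice.SchwingerFamily.OSSpace.expectShiftC_zero (hE1 : 𝔖.IsEuclideanCovariant) (ψ : OSHilbert 𝔖 hE2) :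
    expectShiftC hE1 ψ 0 = ((‖ψ‖ ^ 2 : ℝ) : ℂ) := by
  rw [expectShiftC, cpowMoment]
  simp only [Complex.cpow_zero, integral_const, Complex.real_smul, mul_one]
  rw [osSpectralMeasureReal_real_univ]

/-- **Holomorphy**: `τ ↦ ⟪ψ, e^{-τH}ψ⟫` is holomorphic on the open half-plane `{Re τ > 0}`
(Osterwalder–Schrader I (1973), p. 92: "`T^τ` … is a holomorphic semigroup for `Re τ > 0`"). [cite: OsterwalderSchraderCMP1973, §4.1 p. 92] -/
theorem _root_.Literature.MathematicalPhysics.QuantumLattice.SchwingerFamily.OSSpace.differentiableOn_expectShiftC (hE1 : 𝔖.IsEuclideanCovariant) (ψ : OSHilbert 𝔖 hE2) :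
    DifferentiableOn ℂ (expectShiftC hE1 ψ) {τ | 0 < τ.re} :=
  differentiableOn_cpowMoment (osSpectralMeasureReal_ae_mem_Icc hE1 ψ)

/-- **Continuity up to the imaginary axis**: `τ ↦ ⟪ψ, e^{-τH}ψ⟫` is continuous on `{Re τ ≥ 0}`
(Osterwalder–Schrader I (1973), p. 92: "strongly continuous for `Re τ ≥ 0`"; uses the absence
of an atom of `ν_ψ` at `0`). [cite: OsterwalderSchraderCMP1973, §4.1 p. 92] -/
theorem _root_.Literature.MathematicalPhysics.QuantumLattice.SchwingerFamily.OSSpace.continuousOn_expectShiftC (hE1 : 𝔖.IsEuclideanCovariant) (ψ : OSHilbert 𝔖 hE2) :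
    ContinuousOn (expectShiftC hE1 ψ) {τ | 0 ≤ τ.re} :=
  continuousOn_cpowMoment (osSpectralMeasureReal_ae_mem_Icc hE1 ψ) (osSpectralMeasureReal_zero hE1 ψ)

/-- **Uniform bound** `|⟪ψ, e^{-τH}ψ⟫| ≤ ‖ψ‖²` for `Re τ ≥ 0` (Osterwalder–Schrader I (1973), p. 92:
"uniformly bounded … for `Re τ ≥ 0`"). [cite: OsterwalderSchraderCMP1973, §4.1 p. 92] -/
theorem _root_.Literature.MathematicalPhysics.QuantumLattice.SchwingerFamily.OSSpace.norm_expectShiftC_le (hE1 : 𝔖.IsEuclideanCovariant) (ψ : OSHilbert 𝔖 hE2) {τ : ℂ} (hτ : 0 ≤ τ.re) :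
    ‖expectShiftC hE1 ψ τ‖ ≤ ‖ψ‖ ^ 2 := by
  rw [← osSpectralMeasureReal_real_univ hE1 ψ]
  exact norm_cpowMoment_le (osSpectralMeasureReal_ae_mem_Icc hE1 ψ) hτ

end SchwingerFamily

end Literature.MathematicalPhysics.QuantumFieldTheory
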